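import Summits.QuantumAdvantage.QuantumAdvantage.Theorems.CubicForrelationNearExactIsExactTwelveTypeO896

/-!
# Crux `CubicForrelation.NearExactIsExact` (stmt-QuantumAdvantage-14043) — n = 12: a TYPE-O side is impossible for `Φ ≥ 935/1024`
  (the base sets `904` and `912`, by 2-adic bookkeeping of the partner — no Kasami–Tokura classification needed)

Certificate seat `b2b-cforr-cert` (gen 18).  HONEST FRAMING: kernel-checked lemmas (standard axioms, no `decide`/`native_decide`) about cubic
Boolean pairs on 12 bits: the type-O branch one rung below the landed value `936/1024` (`…TwelveClosed936`).  The level-`≥ 6` branch at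
`Σ e² = 712` is NOT treated here, so NO new value of `θ₁₂` is claimed.  Finite-slice statements; NOT summit progress.

Setting as in `…TwelveTypeO896` (`w = #E`, `τ = τ₀ + 8v`, excess `X ≥ 16v²`); for `Φ ≥ 935/1024`: `Σ τ² ≤ 11392`, `896 < w < 960`, `8 ∣ w`.
* `to18_char_sum_mod16`: `Σ_{x∈E}(−1)^{x·z} ≡ w (mod 16)` for every `z` — the half weights of `E` along a hyperplane are weights of cubics on
  11 bits (`ktg_restrict`), hence multiples of `8` (Ax/McEliece on 11 bits, `to18_cubic_weight_eleven_dvd`).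
* `w = 904`: Walsh inversion gives `Σ_x v(x)(−1)^{x·y} ≡ ±4 (mod 8)` for every `y`, so `Σ v² ≥ 16` (Parseval for `v`) and `Σ X ≥ 256` — but the
  budget leaves `Σ X ≤ 11392 − 4096 − 8·904 = 64`.
* hence `w = 912` and the excess is ZERO (`to18_typeO_ge935_rigid`): `u = 4(−1)^f + τ₀` exactly, and at the character point `c₁` the partner
  has `u_f(c₁) = 4(−1)^{g(c₁)} ∓ 7` (`W_f = 16u_f`; `912 = 16·57`, `57 − 64 = −7`).  This is ODD, so `f` is type O as well
  (`typeO_of_exists_odd`), and the same rigidity for the pair `(g, f)` says `u_f − 4(−1)^g ∈ {±1, ±3}` everywhere — not `∓7`.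
`to18_typeO_ge935_false`, `to18_typeO_lt_935`: a type-O side has `Φ < 935/1024`.

References: Ax (1964) / McEliece (1972); MacWilliams–Sloane (1977) Ch. 15.  Axioms: the standard three. -/

set_option linter.dupNamespace false -- D-0017: single-problem summit ⇒ `QuantumAdvantage.QuantumAdvantage` by design

noncomputable section

namespace Summit.QuantumAdvantage.QuantumAdvantage.Theorems.CubicForrelation.NearExactIsExact

open Finset
open Literature.Computability.QuantumComplexity
open Literature.Computability.QuantumComplexity.BuzetChailloux (bxor zeroVec bxor_bxor_cancel_left bxor_zeroVec zeroVec_bxor bxor_comm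
  bxor_self twist_zeroVec_right twist_bxor_right signOf_sq)
open Literature.Computability.QuantumComplexity.DerivativeWalsh (W sum_W_sq)
open Literature.Computability.QuantumComplexity.Simon (twist_eq_one_or)
open Summit.QuantumAdvantage.QuantumAdvantage.Theorems.NearExactIsExact.Negative (TypeOTwelve.typeO_of_exists_odd)

/-! ### Character sums over a cubic support on 12 bits, modulo 16 -/

/-- **Weights of cubics on 11 bits are multiples of `8`** (Ax / McEliece: `W(0) = 2¹¹ − 2·wt ∈ 16ℤ`). [folklore] -/
theorem to18_cubic_weight_eleven_dvd (e : (Fin 11 → Bool) → Bool) (he : IsDegLeFun 3 e) :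
    8 ∣ #(univ.filter fun y => e y = true) := by
  classical
  obtain ⟨u, hu⟩ := tw_base (n := 11) e he 4 (by norm_num)
  have hW0 : W (fun y => signOf (e y)) zeroVec = 2048 - 2 * (#(univ.filter fun y => e y = true) : ℝ) := by
    unfold W
    rw [sum_congr rfl fun y _ => by rw [twist_zeroVec_right, mul_one]]
    have e1 : ∀ y, signOf (e y) = 1 - 2 * (if e y = true then (1 : ℝ) else 0) := fun y => by
      unfold signOf; cases e y <;> norm_num
    rw [sum_congr rfl fun y _ => e1 y, sum_sub_distrib, sum_const, card_univ, Fintype.card_fun, Fintype.card_bool, Fintype.card_fin,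
      ← mul_sum, sum_boole]
    norm_num
  have h := hu zeroVec
  rw [hW0] at h
  have h' : ((#(univ.filter fun y => e y = true) : ℕ) : ℝ) = 1024 - 8 * (u zeroVec : ℝ) := by norm_num at h ⊢; linarith
  have h'' : ((#(univ.filter fun y => e y = true) : ℕ) : ℤ) = 1024 - 8 * u zeroVec := by exact_mod_cast h'
  have : (8 : ℤ) ∣ ((#(univ.filter fun y => e y = true) : ℕ) : ℤ) := ⟨128 - u zeroVec, by rw [h'']; ring⟩
  exact_mod_cast this

/-- **Character sums over a cubic support on 12 bits are `≡ #E (mod 16)`**: for cubic `c` on 12 bits and any `z`,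
`Σ_{x : c(x)=1} (−1)^{x·z} = #{c = 1} − 16m` for an integer `m` (for `z ≠ 0` the sum is `#E − 2·#{c = 1, ⟨x,z⟩ = 1}` and the half weight is
the weight of a cubic on 11 bits, a multiple of `8`). [this work] -/
theorem to18_char_sum_mod16 (c : (Fin (6 + 6) → Bool) → Bool) (hc : IsDegLeFun 3 c) (z : Fin (6 + 6) → Bool) :
    ∃ m : ℤ, ∑ x ∈ univ.filter (fun x => c x = true), twist x z = (#(univ.filter fun x => c x = true) : ℝ) - 16 * (m : ℝ) := by
  classical
  rw [ktg_F_half c z]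
  by_cases hz : ∃ i₀, z i₀ = true
  · obtain ⟨i₀, hi₀⟩ := hz
    obtain ⟨cT, hcT, hcardT⟩ := ktg_restrict (k := 11) c hc z i₀ hi₀ true
    obtain ⟨q, hq⟩ := to18_cubic_weight_eleven_dvd cT hcT
    rw [hcardT] at hq
    refine ⟨q, ?_⟩
    rw [hq]; push_cast; ring
  · push Not at hz
    have hA0 : #(univ.filter fun x : Fin (6 + 6) → Bool =>
        c x = true ∧ decide (Odd #(univ.filter fun i => (x i && z i) = true)) = true) = 0 := by
      refine card_eq_zero.2 (filter_eq_empty_iff.2 fun x _ h => ?_)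
      have hempty : (univ.filter fun i : Fin (6 + 6) => (x i && z i) = true) = ∅ :=
        filter_eq_empty_iff.2 fun i _ hi => by
          have := hz i
          rw [Bool.and_eq_true] at hi
          rw [hi.2] at this
          exact this rfl
      rw [hempty, card_empty] at h
      simp at h
    rw [hA0]
    exact ⟨0, by norm_num⟩

/-! ### Rigidity of a type-O side at `Φ ≥ 935/1024`: base set `912`, zero excess -/

/-- **Type O at `Φ ≥ 935/1024`: the base set has `912` points and the excess vanishes** — `u(x) − 4(−1)^{f(x)} ∈ {±1, ±3}` for all `x`.
(`w = 904` is excluded 2-adically: `Σ_x v(−1)^{x·y} ≡ ±4 (mod 8)` forces `Σ v² ≥ 16`, i.e. excess `≥ 256 > 64`.)  NOT summit progress.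
[this work] -/
theorem to18_typeO_ge935_rigid (f g : (Fin (6 + 6) → Bool) → Bool) (hf : IsDegLeFun 3 f) (hg : IsDegLeFun 3 g)
    (u : (Fin (6 + 6) → Bool) → ℤ) (hu : ∀ x, W (fun y => signOf (g y)) x = (2 : ℝ) ^ 4 * (u x : ℝ))
    (hodd : ∃ x, Odd (u x)) (hΦ : (935 / 1024 : ℝ) ≤ forrelation f g) :
    #(univ.filter fun x : Fin (6 + 6) → Bool => (Odd (u x / 2) ↔ Odd (u x / 2 / 2))) = 912 ∧
    ∀ x, u x - 4 * sZ (f x) = 1 ∨ u x - 4 * sZ (f x) = -1 ∨ u x - 4 * sZ (f x) = 3 ∨ u x - 4 * sZ (f x) = -3 := by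
  classical
  have hall : ∀ x, Odd (u x) := TypeOTwelve.typeO_of_exists_odd g u hg hu hodd
  have hu' : ∀ x, W (fun y => signOf (g y)) x = (2 : ℝ) ^ (2 * 2) * (u x : ℝ) := fun x => (hu x).trans (by norm_num)
  have hd1 : IsDegLeFun 1 (fun x => decide (Odd (u x / 2))) := z2_digitOne 2 g u hg hu' hall
  have hd2 : IsDegLeFun 3 (fun x => decide (Odd (u x / 2 / 2))) := z2_digitTwo 2 g u hg hu' hall
  set E := univ.filter (fun x : Fin (6 + 6) → Bool => (Odd (u x / 2) ↔ Odd (u x / 2 / 2))) with hEdef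
  have hdegE : IsDegLeFun (2 + 1) (fun x => (decide (Odd (u x / 2)) ^^ decide (Odd (u x / 2 / 2))) ^^ true) :=
    tb_isDegLeFun_xor_const (bb_isDegLeFun_bxor (hd1.mono (by norm_num)) hd2) true
  have hsetE : (univ.filter fun x : Fin (6 + 6) → Bool =>
      ((decide (Odd (u x / 2)) ^^ decide (Odd (u x / 2 / 2))) ^^ true) = true) = E := by
    rw [hEdef]
    apply filter_congr
    intro x _
    by_cases h1 : Odd (u x / 2) <;> by_cases h2 : Odd (u x / 2 / 2) <;> simp [h1, h2]
  have hsumE : (∑ x, (if (Odd (u x / 2) ↔ Odd (u x / 2 / 2)) then 1 else 0 : ℤ)) = #E := by rw [sum_boole]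
  -- `896 < #E < 960`, `8 ∣ #E`
  obtain ⟨hElo, hEhi⟩ := to18_typeO_gt932_weight f g hf hg u hu hodd (by linarith)
  change 896 < #E at hElo
  change #E < 960 at hEhi
  have hE8 : 8 ∣ #E := by
    obtain ⟨uE, huE⟩ := tw_base (n := 6 + 6) _ hdegE 4 (by norm_num)
    have hW0 : W (fun y => signOf ((decide (Odd (u y / 2)) ^^ decide (Odd (u y / 2 / 2))) ^^ true)) zeroVec =
        4096 - 2 * (#E : ℝ) := by
      unfold W
      rw [sum_congr rfl fun y _ => by rw [twist_zeroVec_right, mul_one]]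
      have e1 : ∀ y, signOf ((decide (Odd (u y / 2)) ^^ decide (Odd (u y / 2 / 2))) ^^ true) =
          1 - 2 * (if ((decide (Odd (u y / 2)) ^^ decide (Odd (u y / 2 / 2))) ^^ true) = true then (1 : ℝ) else 0) := fun y => by
        unfold signOf; cases ((decide (Odd (u y / 2)) ^^ decide (Odd (u y / 2 / 2))) ^^ true) <;> norm_num
      rw [sum_congr rfl fun y _ => e1 y, sum_sub_distrib, sum_const, card_univ, Fintype.card_fun, Fintype.card_bool, Fintype.card_fin,
        ← mul_sum, sum_boole, hsetE]
      norm_num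
    have h := huE zeroVec
    rw [hW0] at h
    have h' : ((#E : ℕ) : ℝ) = 2048 - 8 * (uE zeroVec : ℝ) := by norm_num at h ⊢; linarith
    have h'' : ((#E : ℕ) : ℤ) = 2048 - 8 * uE zeroVec := by exact_mod_cast h'
    have : (8 : ℤ) ∣ ((#E : ℕ) : ℤ) := ⟨256 - uE zeroVec, by rw [h'']; ring⟩
    exact_mod_cast this
  -- budget `Σ τ² ≤ 11392`
  have hbud := tw12_budget f g u hu
  have hT : (∑ x, (u x - 4 * sZ (f x)) ^ 2 : ℤ) ≤ 11392 := by
    have h' : ((∑ x, (u x - 4 * sZ (f x)) ^ 2 : ℤ) : ℝ) ≤ 11392 := by rw [hbud]; linarith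
    exact_mod_cast h'
  -- base pattern and wild function
  choose v hv using fun x => to12_pt_mod8 (u x) (sZ (f x)) (hall x) (tp_sZ_cases (f x))
  set τ₀ : (Fin (6 + 6) → Bool) → ℤ := fun x =>
    sZ (decide (Odd (u x / 2))) * (1 - 4 * (if (Odd (u x / 2) ↔ Odd (u x / 2 / 2)) then 1 else 0)) with hτ₀def
  have hvx : ∀ x, u x - 4 * sZ (f x) = τ₀ x + 8 * v x := fun x => hv x
  have hτ₀val : ∀ x, τ₀ x = 1 ∨ τ₀ x = -1 ∨ τ₀ x = 3 ∨ τ₀ x = -3 := by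
    intro x
    simp only [τ₀]
    rcases tp_sZ_cases (decide (Odd (u x / 2))) with h | h <;> rw [h] <;> split_ifs <;> norm_num
  have hτ₀sq : ∀ x, τ₀ x ^ 2 = 1 + 8 * (if (Odd (u x / 2) ↔ Odd (u x / 2 / 2)) then 1 else 0 : ℤ) := by
    intro x
    simp only [τ₀]
    rcases tp_sZ_cases (decide (Odd (u x / 2))) with h | h <;> rw [h] <;> split_ifs <;> norm_num
  have hsumτ₀ : ∑ x, τ₀ x ^ 2 = 4096 + 8 * #E := by
    rw [sum_congr rfl fun x _ => hτ₀sq x, sum_add_distrib, ← mul_sum, hsumE, sum_const, card_univ, Fintype.card_fun,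
      Fintype.card_bool, Fintype.card_fin]
    norm_num
  set X : (Fin (6 + 6) → Bool) → ℤ := fun x => (τ₀ x + 8 * v x) ^ 2 - τ₀ x ^ 2 with hXdef
  have hXv : ∀ x, 16 * v x ^ 2 ≤ X x := by
    intro x
    have hid : X x - 16 * v x ^ 2 = 16 * (v x * (3 * v x + τ₀ x)) := by simp only [X]; ring
    have hτ3 : -3 ≤ τ₀ x ∧ τ₀ x ≤ 3 := by rcases hτ₀val x with h | h | h | h <;> rw [h] <;> norm_num
    have hprod : 0 ≤ v x * (3 * v x + τ₀ x) := by
      rcases lt_trichotomy (v x) 0 with h0 | h0 | h0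
      · exact mul_nonneg_of_nonpos_of_nonpos h0.le (by linarith)
      · rw [h0]; simp
      · exact mul_nonneg h0.le (by linarith)
    linarith
  have hTdec : (∑ x, (u x - 4 * sZ (f x)) ^ 2 : ℤ) = ∑ x, τ₀ x ^ 2 + ∑ x, X x := by
    rw [← sum_add_distrib]
    exact sum_congr rfl fun x _ => by rw [hvx x]; simp only [X]; ring
  have hXsum : ∑ x, X x ≤ 7296 - 8 * #E := by rw [hTdec, hsumτ₀] at hT; linarith
  have hv2 : 16 * ∑ x, v x ^ 2 ≤ ∑ x, X x := by rw [mul_sum]; exact sum_le_sum fun x _ => hXv x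
  -- `#E ≤ 912`, so `#E ∈ {904, 912}`
  have hE912 : #E ≤ 912 := by
    have h0 : (0 : ℤ) ≤ ∑ x, X x := le_trans (by positivity) hv2
    have : (8 : ℤ) * #E ≤ 7296 := by linarith
    have : 8 * #E ≤ 7296 := mod_cast this
    omega
  have hEcases : #E = 904 ∨ #E = 912 := by omega
  -- the character machinery (as in `to18_typeO_E896_false`)
  obtain ⟨c₁, b₁, hcb⟩ := stub_affineForm (6 + 6) _ hd1
  have hsb : signOf b₁ = 1 ∨ signOf b₁ = -1 := by cases b₁ <;> simp [signOf]
  set cE : (Fin (6 + 6) → Bool) → Bool := fun x => (decide (Odd (u x / 2)) ^^ decide (Odd (u x / 2 / 2))) ^^ true with hcEdef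
  have hcE3 : IsDegLeFun 3 cE := hdegE
  have hcEcard : #(univ.filter fun x => cE x = true) = #E := by rw [hsetE]
  have hcEiff : ∀ x, cE x = true ↔ (Odd (u x / 2) ↔ Odd (u x / 2 / 2)) := by
    intro x; simp only [cE]; by_cases h1 : Odd (u x / 2) <;> by_cases h2 : Odd (u x / 2 / 2) <;> simp [h1, h2]
  have hτ₀R : ∀ x, (τ₀ x : ℝ) = signOf b₁ * twist c₁ x * (1 - 4 * (if cE x = true then 1 else 0)) := by
    intro x
    simp only [τ₀]
    push_cast
    rw [tp_sZ_cast, hcb x]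
    by_cases h : (Odd (u x / 2) ↔ Odd (u x / 2 / 2))
    · rw [if_pos h, if_pos ((hcEiff x).2 h)]
    · rw [if_neg h, if_neg (fun h' => h ((hcEiff x).1 h'))]
  obtain ⟨uf, huf⟩ := tw_base (n := 6 + 6) f hf 4 (by norm_num)
  have hinvg : ∀ y, ∑ x, (u x : ℝ) * twist x y = 256 * signOf (g y) := by
    intro y
    have h := tz_inversion (fun y => signOf (g y)) y
    rw [sum_congr rfl fun x _ => by rw [hu x]] at h
    have h' : (2 : ℝ) ^ 4 * ∑ x, (u x : ℝ) * twist x y = 2 ^ (6 + 6) * signOf (g y) := by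
      rw [mul_sum]; rw [← h]; exact sum_congr rfl fun x _ => by ring
    have e16 : (2 : ℝ) ^ (6 + 6) = 2 ^ 4 * 256 := by norm_num
    rw [e16, mul_assoc] at h'
    exact mul_left_cancel₀ (by positivity) h'
  have hWv : ∀ y, W (fun x => (v x : ℝ)) y = ∑ x, (v x : ℝ) * twist x y := fun y => rfl
  have h64 : ∀ y, 64 * (uf y : ℝ) = 256 * signOf (g y) - ∑ x, (τ₀ x : ℝ) * twist x y - 8 * W (fun x => (v x : ℝ)) y := by
    intro y
    have hW4 : 4 * W (fun x => signOf (f x)) y = ∑ x, 4 * (signOf (f x) * twist x y) := by unfold W; rw [mul_sum]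
    have e64 : 64 * (uf y : ℝ) = 4 * W (fun x => signOf (f x)) y := by rw [huf y]; ring
    rw [e64, hW4, hWv y, mul_sum, ← hinvg y, ← sum_sub_distrib, ← sum_sub_distrib]
    refine sum_congr rfl fun x _ => ?_
    have h := hvx x
    have h' : ((u x : ℤ) : ℝ) - 4 * (sZ (f x) : ℝ) = (τ₀ x : ℝ) + 8 * (v x : ℝ) := by exact_mod_cast h
    rw [tp_sZ_cast] at h'
    have : (4 : ℝ) * signOf (f x) = (u x : ℝ) - (τ₀ x : ℝ) - 8 * (v x : ℝ) := by linarith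
    rw [show (4 : ℝ) * (signOf (f x) * twist x y) = (4 * signOf (f x)) * twist x y by ring, this]; ring
  have hτ₀sum : ∀ y, ∑ x, (τ₀ x : ℝ) * twist x y =
      signOf b₁ * ((if bxor c₁ y = (fun _ => false) then (2 : ℝ) ^ (6 + 6) else 0) -
        4 * ∑ x ∈ univ.filter (fun x => cE x = true), twist x (bxor c₁ y)) := by
    intro y
    have e1 : ∀ x, (τ₀ x : ℝ) * twist x y = signOf b₁ * twist x (bxor c₁ y) -
        signOf b₁ * (4 * (if cE x = true then twist x (bxor c₁ y) else 0)) := by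
      intro x
      rw [hτ₀R x, twist_bxor_right, twist_comm x c₁]; split_ifs <;> ring
    rw [sum_congr rfl fun x _ => e1 x, sum_sub_distrib, ← mul_sum, ← mul_sum, ← mul_sum, tz_sum_twist_left, ← sum_filter]
    ring
  have hParsv : ∑ y, W (fun x => (v x : ℝ)) y ^ 2 = 4096 * ∑ x, ((v x : ℝ)) ^ 2 := by
    rw [sum_W_sq]; norm_num
  -- `#E = 904` is impossible: `W_v(y) ≡ ±4 (mod 8)` everywhere
  have hE : #E = 912 := by
    rcases hEcases with h904 | h912
    · exfalso
      have hK : ∀ y, ∃ K : ℤ, W (fun x => (v x : ℝ)) y = 8 * (K : ℝ) + 4 * signOf b₁ := by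
        intro y
        obtain ⟨m, hm⟩ := to18_char_sum_mod16 cE hcE3 (bxor c₁ y)
        rw [hcEcard, h904] at hm
        have h := h64 y
        rw [hτ₀sum y, hm] at h
        have hsg : signOf (g y) = 1 ∨ signOf (g y) = -1 := by cases g y <;> simp [signOf]
        by_cases h0 : bxor c₁ y = (fun _ => false)
        · rw [if_pos h0] at h
          rcases hsb with hs | hs <;> rw [hs] at h ⊢ <;> rcases hsg with hg' | hg' <;> rw [hg'] at h <;> norm_num at h ⊢
          · exact ⟨4 - 64 + 56 - m - uf y, by push_cast; linarith⟩
          · exact ⟨-4 - 64 + 56 - m - uf y, by push_cast; linarith⟩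
          · exact ⟨4 + 64 - 56 + m - uf y, by push_cast; linarith⟩
          · exact ⟨-4 + 64 - 56 + m - uf y, by push_cast; linarith⟩
        · rw [if_neg h0] at h
          rcases hsb with hs | hs <;> rw [hs] at h ⊢ <;> rcases hsg with hg' | hg' <;> rw [hg'] at h <;> norm_num at h ⊢
          · exact ⟨4 + 56 - m - uf y, by push_cast; linarith⟩
          · exact ⟨-4 + 56 - m - uf y, by push_cast; linarith⟩
          · exact ⟨4 - 56 + m - uf y, by push_cast; linarith⟩
          · exact ⟨-4 - 56 + m - uf y, by push_cast; linarith⟩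
      have h16 : ∀ y, 16 ≤ W (fun x => (v x : ℝ)) y ^ 2 := by
        intro y
        obtain ⟨K, hK⟩ := hK y
        rw [hK]
        rcases hsb with hs | hs <;> rw [hs]
        · have : (8 * (K : ℝ) + 4 * 1) ^ 2 = 16 * (2 * (K : ℝ) + 1) ^ 2 := by ring
          rw [this]
          have h1 : (1 : ℝ) ≤ (2 * (K : ℝ) + 1) ^ 2 := by
            have hK' : (2 * K + 1 ≤ -1) ∨ (1 ≤ 2 * K + 1) := by omega
            have := tp_sq_ge (k := 1) (by norm_num) hK'
            exact_mod_cast this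
          linarith
        · have : (8 * (K : ℝ) + 4 * -1) ^ 2 = 16 * (2 * (K : ℝ) - 1) ^ 2 := by ring
          rw [this]
          have h1 : (1 : ℝ) ≤ (2 * (K : ℝ) - 1) ^ 2 := by
            have hK' : (2 * K - 1 ≤ -1) ∨ (1 ≤ 2 * K - 1) := by omega
            have := tp_sq_ge (k := 1) (by norm_num) hK'
            exact_mod_cast this
          linarith
      have hsum16 : (16 : ℝ) * 4096 ≤ ∑ y, W (fun x => (v x : ℝ)) y ^ 2 := by
        have h := sum_le_sum fun y (_ : y ∈ (univ : Finset (Fin (6 + 6) → Bool))) => h16 y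
        rw [sum_const, card_univ, Fintype.card_fun, Fintype.card_bool, Fintype.card_fin] at h
        norm_num at h ⊢
        linarith
      rw [hParsv] at hsum16
      have hv16 : (16 : ℝ) ≤ ∑ x, ((v x : ℝ)) ^ 2 := by linarith
      have hv16' : (16 : ℤ) ≤ ∑ x, v x ^ 2 := by exact_mod_cast hv16
      rw [h904] at hXsum
      norm_num at hXsum
      linarith
    · exact h912
  refine ⟨hE, fun x => ?_⟩
  -- zero excess: `v ≡ 0`
  have hXsum0 : ∑ x, X x ≤ 0 := by rw [hE] at hXsum; norm_num at hXsum; exact hXsum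
  have hv20 : ∑ x, v x ^ 2 ≤ 0 := by linarith
  have hv0 : v x = 0 := by
    have hz : ∑ y, v y ^ 2 = 0 := le_antisymm hv20 (sum_nonneg fun y _ => sq_nonneg _)
    exact pow_eq_zero_iff (n := 2) (by norm_num) |>.1 ((sum_eq_zero_iff_of_nonneg fun y _ => sq_nonneg (v y)).1 hz x (mem_univ x))
  have h := hvx x
  rw [hv0, mul_zero, add_zero] at h
  rw [h]; exact hτ₀val x

/-! ### The theorem -/

/-- **A type-O side is impossible for `Φ ≥ 935/1024` on 12 bits.**  By `to18_typeO_ge935_rigid` the type-O side `g` has `#E = 912` at zero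
excess; Walsh inversion at the character point `c₁` of the affine digit gives `u_f(c₁) = 4(−1)^{g(c₁)} ∓ 7` for the partner (`W_f = 16u_f`),
which is odd, so `f` is type O too; the same rigidity for `(g, f)` demands `u_f − 4(−1)^g ∈ {±1, ±3}` — contradiction.  Finite-slice statement;
NOT summit progress. [this work] -/
theorem to18_typeO_ge935_false (f g : (Fin (6 + 6) → Bool) → Bool) (hf : IsDegLeFun 3 f) (hg : IsDegLeFun 3 g)
    (u : (Fin (6 + 6) → Bool) → ℤ) (hu : ∀ x, W (fun y => signOf (g y)) x = (2 : ℝ) ^ 4 * (u x : ℝ))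
    (hodd : ∃ x, Odd (u x)) (hΦ : (935 / 1024 : ℝ) ≤ forrelation f g) : False := by
  classical
  obtain ⟨hE, hrig⟩ := to18_typeO_ge935_rigid f g hf hg u hu hodd hΦ
  have hall : ∀ x, Odd (u x) := TypeOTwelve.typeO_of_exists_odd g u hg hu hodd
  have hu' : ∀ x, W (fun y => signOf (g y)) x = (2 : ℝ) ^ (2 * 2) * (u x : ℝ) := fun x => (hu x).trans (by norm_num)
  have hd1 : IsDegLeFun 1 (fun x => decide (Odd (u x / 2))) := z2_digitOne 2 g u hg hu' hall
  set E := univ.filter (fun x : Fin (6 + 6) → Bool => (Odd (u x / 2) ↔ Odd (u x / 2 / 2))) with hEdef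
  -- base pattern (zero excess): `u − 4s = τ₀`
  set τ₀ : (Fin (6 + 6) → Bool) → ℤ := fun x =>
    sZ (decide (Odd (u x / 2))) * (1 - 4 * (if (Odd (u x / 2) ↔ Odd (u x / 2 / 2)) then 1 else 0)) with hτ₀def
  have hτ : ∀ x, u x - 4 * sZ (f x) = τ₀ x := by
    intro x
    obtain ⟨w8, hw8⟩ := to12_pt_mod8 (u x) (sZ (f x)) (hall x) (tp_sZ_cases (f x))
    change u x - 4 * sZ (f x) = τ₀ x + 8 * w8 at hw8
    have hτv : τ₀ x = 1 ∨ τ₀ x = -1 ∨ τ₀ x = 3 ∨ τ₀ x = -3 := by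
      simp only [τ₀]
      rcases tp_sZ_cases (decide (Odd (u x / 2))) with h | h <;> rw [h] <;> split_ifs <;> norm_num
    have hw0 : w8 = 0 := by rcases hrig x with h | h | h | h <;> rcases hτv with h' | h' | h' | h' <;> omega
    rw [hw8, hw0]; ring
  obtain ⟨c₁, b₁, hcb⟩ := stub_affineForm (6 + 6) _ hd1
  have hsb : signOf b₁ = 1 ∨ signOf b₁ = -1 := by cases b₁ <;> simp [signOf]
  set cE : (Fin (6 + 6) → Bool) → Bool := fun x => (decide (Odd (u x / 2)) ^^ decide (Odd (u x / 2 / 2))) ^^ true with hcEdef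
  have hsetE : (univ.filter fun x : Fin (6 + 6) → Bool => cE x = true) = E := by
    rw [hEdef]
    apply filter_congr
    intro x _
    simp only [cE]
    by_cases h1 : Odd (u x / 2) <;> by_cases h2 : Odd (u x / 2 / 2) <;> simp [h1, h2]
  have hcEiff : ∀ x, cE x = true ↔ (Odd (u x / 2) ↔ Odd (u x / 2 / 2)) := by
    intro x; simp only [cE]; by_cases h1 : Odd (u x / 2) <;> by_cases h2 : Odd (u x / 2 / 2) <;> simp [h1, h2]
  have hτ₀R : ∀ x, (τ₀ x : ℝ) = signOf b₁ * twist c₁ x * (1 - 4 * (if cE x = true then 1 else 0)) := by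
    intro x
    simp only [τ₀]
    push_cast
    rw [tp_sZ_cast, hcb x]
    by_cases h : (Odd (u x / 2) ↔ Odd (u x / 2 / 2))
    · rw [if_pos h, if_pos ((hcEiff x).2 h)]
    · rw [if_neg h, if_neg (fun h' => h ((hcEiff x).1 h'))]
  -- the partner at the Ax level and the inversion at `y = c₁`
  obtain ⟨uf, huf⟩ := tw_base (n := 6 + 6) f hf 4 (by norm_num)
  have hinvg : ∑ x, (u x : ℝ) * twist x c₁ = 256 * signOf (g c₁) := by
    have h := tz_inversion (fun y => signOf (g y)) c₁
    rw [sum_congr rfl fun x _ => by rw [hu x]] at h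
    have h' : (2 : ℝ) ^ 4 * ∑ x, (u x : ℝ) * twist x c₁ = 2 ^ (6 + 6) * signOf (g c₁) := by
      rw [mul_sum]; rw [← h]; exact sum_congr rfl fun x _ => by ring
    have e16 : (2 : ℝ) ^ (6 + 6) = 2 ^ 4 * 256 := by norm_num
    rw [e16, mul_assoc] at h'
    exact mul_left_cancel₀ (by positivity) h'
  have h64 : 64 * (uf c₁ : ℝ) = 256 * signOf (g c₁) - ∑ x, (τ₀ x : ℝ) * twist x c₁ := by
    have hW4 : 4 * W (fun x => signOf (f x)) c₁ = ∑ x, 4 * (signOf (f x) * twist x c₁) := by unfold W; rw [mul_sum]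
    have e64 : 64 * (uf c₁ : ℝ) = 4 * W (fun x => signOf (f x)) c₁ := by rw [huf c₁]; ring
    rw [e64, hW4, ← hinvg, ← sum_sub_distrib]
    refine sum_congr rfl fun x _ => ?_
    have h' : ((u x : ℤ) : ℝ) - 4 * (sZ (f x) : ℝ) = (τ₀ x : ℝ) := by exact_mod_cast hτ x
    rw [tp_sZ_cast] at h'
    have : (4 : ℝ) * signOf (f x) = (u x : ℝ) - (τ₀ x : ℝ) := by linarith
    rw [show (4 : ℝ) * (signOf (f x) * twist x c₁) = (4 * signOf (f x)) * twist x c₁ by ring, this]; ring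
  have hτ₀c₁ : ∑ x, (τ₀ x : ℝ) * twist x c₁ = signOf b₁ * 448 := by
    have e1 : ∀ x, (τ₀ x : ℝ) * twist x c₁ = signOf b₁ * (1 - 4 * (if cE x = true then (1 : ℝ) else 0)) := by
      intro x
      rw [hτ₀R x, twist_comm x c₁]
      rcases twist_eq_one_or c₁ x with ht | ht <;> rw [ht] <;> ring
    rw [sum_congr rfl fun x _ => e1 x, ← mul_sum, sum_sub_distrib, sum_const, card_univ, Fintype.card_fun, Fintype.card_bool,
      Fintype.card_fin, ← mul_sum, sum_boole, hsetE, hE]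
    norm_num
  -- `u_f(c₁) = 4(−1)^{g(c₁)} − 7·signOf b₁`
  have hsg : signOf (g c₁) = 1 ∨ signOf (g c₁) = -1 := by cases g c₁ <;> simp [signOf]
  have hufc₁ : (uf c₁ : ℝ) = 4 * signOf (g c₁) - 7 * signOf b₁ := by rw [hτ₀c₁] at h64; linarith
  have hufodd : Odd (uf c₁) := by
    rcases hsg with h | h <;> rcases hsb with h' | h' <;> rw [h, h'] at hufc₁ <;> norm_num at hufc₁
    · rw [show uf c₁ = -3 from mod_cast hufc₁]; decide
    · rw [show uf c₁ = 11 from mod_cast hufc₁]; decide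
    · rw [show uf c₁ = -11 from mod_cast hufc₁]; decide
    · rw [show uf c₁ = 3 from mod_cast hufc₁]; decide
  -- so `f` is type O, and the rigidity for `(g, f)` fails at `c₁`
  have hΦ' : forrelation g f = forrelation f g := by
    rw [Summit.QuantumAdvantage.QuantumAdvantage.Theorems.SignedCubicForrelationNotPrBPP.Negative.HalfQuad.forrelation_comm]
  obtain ⟨-, hrig'⟩ := to18_typeO_ge935_rigid g f hg hf uf huf ⟨c₁, hufodd⟩ (by rw [hΦ']; exact hΦ)
  have h := hrig' c₁
  have hZ : (uf c₁ : ℝ) - 4 * (sZ (g c₁) : ℝ) = -7 * signOf b₁ := by rw [tp_sZ_cast]; linarith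
  rcases hsb with h' | h' <;> rw [h'] at hZ <;> norm_num at hZ
  · have : uf c₁ - 4 * sZ (g c₁) = -7 := mod_cast hZ
    omega
  · have : uf c₁ - 4 * sZ (g c₁) = 7 := mod_cast hZ
    omega

/-- **A type-O side has `Φ < 935/1024`** (12 bits). NOT summit progress. [this work] -/
theorem to18_typeO_lt_935 (f g : (Fin (6 + 6) → Bool) → Bool) (hf : IsDegLeFun 3 f) (hg : IsDegLeFun 3 g)
    (u : (Fin (6 + 6) → Bool) → ℤ) (hu : ∀ x, W (fun y => signOf (g y)) x = (2 : ℝ) ^ 4 * (u x : ℝ))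
    (hodd : ∃ x, Odd (u x)) : forrelation f g < 935 / 1024 := by
  by_contra h
  exact to18_typeO_ge935_false f g hf hg u hu hodd (le_of_not_gt h)

end Summit.QuantumAdvantage.QuantumAdvantage.Theorems.CubicForrelation.NearExactIsExact

end
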